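import Literature.AlgebraicGeometry.Motives.CrystallineRealization
import Literature.AlgebraicGeometry.Motives.PeriodComparison
import HarnessLib

/-!
# Crystalline Tate classes at a `W(k)`-model and "Hodge ⇒ crystalline-Tate" (Ogus 1982, §4)

Family `hodge`, topic `Literature/AlgebraicGeometry/Motives`. The LOCAL, model-wise companion of
`Motives/AbsolutelyTateClasses`: typed vocabulary for the named input "the de Rham component
of a Hodge class is a crystalline Tate class, `φ(α_dR) = pʳ · α_dR` under the Berthelot–Ogus
isomorphism `H²ʳ_dR(X_K/K) ≅ H²ʳ_cris(X_k/W) ⊗ K`, at the unramified primes of good reduction"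
(route `HodgeConjecture/PadicSemiregularLift`, item P4 `OgusCrystallineTate`, whose crux
`SemiregularSeedsOnAnchors` takes classes "φ-Tate ON THE NOSE and of Hodge origin" as input), over
the tree's crystalline interface `CrystallineRealization p k` (`Motives/CrystallineRealization`:
semilinear Frobenius `frobK`, Berthelot–Ogus map `bo 𝒳 i : Hⁱ(X_k) → Hⁱ_dR(X_K/K)`, Tate classes
`tateClasses X r = {x | φ x = pʳ x}`) and period interface `PeriodRealization K`
(`Motives/PeriodComparison`: `IsHodgeRelativeTo`), `K = K(p, k) = W(k)[1/p]`.

**Informal content (Ogus 1982, §4, (4.1.2)–(4.1.3), (4.11), Thm. 4.14).** For `R` a smooth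
`ℤ`-algebra, `X/R` smooth proper and a `W = W(k)`-valued point `σ` of `Spec R` (`k` perfect of
characteristic `p`), `ξ ∈ H²ʳ_DR(X/R)` is a *Tate class at `σ`* iff `Φ σ_cris(ξ) = pʳ σ_cris(ξ)`
(Ogus writes `Φ σ_cris ξ = σ_cris ξ` after a Tate twist), `σ_cris : H_DR(X/R) ⊗_σ K ≅ H_cris(X_σ̄/W) ⊗ K`
the Berthelot–Ogus isomorphism; *absolutely Tate* iff Tate at every `W`-valued point (every `W`);
(4.11.1) ∧ (4.11.2) (Ogus's "Hopes"): a class Hodge at some complex embedding is absolutely Tate —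
which Thm. 4.14 proves for abelian varieties, Fermat hypersurfaces, K3 surfaces and projective
spaces; the general assertion over number fields is registered in this tree as the summit
obligation `Summit.HodgeConjecture.HodgeConjecture.HodgeClassesAbsolutelyTate`, not in
`Literature`. At ONE `W(k)`-valued point the data are: the smooth proper `W(k)`-scheme `𝒳 = X ⊗_σ W`
with special fibre `X_k` and generic fibre `X_K`, the class `ξ ⊗ 1 ∈ H²ʳ_dR(X_K/K)`, and the
condition `φ (bo⁻¹ (ξ ⊗ 1)) = pʳ bo⁻¹(ξ ⊗ 1)` — all expressible over `CrystallineRealization`: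

* `C.IsTateAtModel 𝒳 r α` : the class `α ∈ H²ʳ_dR(X_K/K)` of the generic fibre of the
  `W(k)`-scheme `𝒳` is a *crystalline Tate class at the model `𝒳`*: every `x ∈ H²ʳ(X_k)` with
  `bo x = α` satisfies `φ x = pʳ x` (`bo` is bijective for `𝒳` smooth proper, `bijective_bo`, so
  "every" = "the"; semilinear `φ`, on the nose: Ogus (4.1.2) at the point `σ`).
* `C.HodgeClassesAreCrystallineTate P hP n 𝒳` : for a period realization `P` over `K` ON THE SAME
  de Rham realization (`hP : P.dR = C.dR`, see the design notes), every `α ∈ H²ʳ_dR(X_K/K)` which is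
  a Hodge class relative to some `ι : K →+* ℂ` (`P.IsHodgeRelativeTo ι hXι r α`:
  `iso_ι (1 ⊗ α) = (2πi)ʳ (1 ⊗ β)`, `β` a RATIONAL Hodge class on `X_K ⊗_ι ℂ` — "of Hodge origin,
  on the nose") is a crystalline Tate class at `𝒳`. A `Prop`-valued DEFINITION, a PROPERTY of
  the realization data `C`, `P` and of the model `(n, 𝒳)` (`𝒳` intended a smooth proper model of
  relative dimension `n`, `WittScheme.IsSmoothProperModel n 𝒳`), consumed by routes as a
  hypothesis schema (like `BerthelotOgusLineBundleLifting C`); no universal assertion is made.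

**Status of the model-wise form.** Ogus's "absolutely Tate" ((4.1.3) with (4.4.2): Tate at the
`W`-points of SOME smooth `ℤ`-model) allows finitely many / special primes to be discarded; the
model-wise form asks Tateness at a GIVEN smooth proper `W(k)`-model and has no such escape, so it
is formally stronger than (4.11.1) ∧ (4.11.2) at that prime. It is nevertheless a consequence
of algebraicity of the rational Hodge classes of `X_K ⊗_ι ℂ` (a `K`-rational de Rham class which
is `(2πi)ʳ` times a rational combination of cycle classes is a `ℚ`-combination of classes of
`K`-rational cycles by a Galois-norm argument, and classes of `K`-rational cycles / Chern characters
of bundles extending to `𝒳` are crystalline Tate at every smooth proper model: Gillet–Messing 1987,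
Berthelot–Ogus 1983 Thm. 4.3 and Cor. 3.7 — here `isTateAtModel_chDR_restrictGeneric`); for
abelian varieties over number fields compare Ogus 1982 Thm. 4.14 and Blasius 1994 (Hodge classes
are de Rham).
-- TODO(general form): Ogus (4.11) is stated for a field of characteristic zero, finite families of
-- smooth schemes with indices (tensor spaces), and Tateness at the `W`-valued points of some smooth
-- `ℤ`-model; the passage from a class over a finitely generated field `k₁ ⊂ K` to `H_dR(X_K/K)`
-- needs a de Rham base-change structure `H_dR(X/k₁) ⊗_{k₁} K ≅ H_dR(X_K/K)` not yet in the tree.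

**What is proved here.** `isTateAtModel_bo_iff` (for `𝒳` smooth proper, `bo x` is crystalline
Tate at `𝒳` iff `φ x = pʳ x`); `isTateAtModel_chDR_restrictGeneric` (the de Rham Chern character
`chᵣ(E|X_K)` of a vector bundle `E` on a smooth proper `𝒳` is crystalline Tate at `𝒳`:
`bo (ch^cris(E|X_k)) = ch^dR(E|X_K)`, `bo_chCris`, and `φ chᵣ^cris = pʳ chᵣ^cris`, `frobK_chCris`);
the unfolding `HodgeClassesAreCrystallineTate.mem_tateClasses` (the shape consumed by the route:
`bo x` of Hodge origin ⇒ `x ∈ tateClasses`); and the reduction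
`hodgeClassesAreCrystallineTate_of_forall_mem_ratAlgebraicClasses` (if the `bo`-preimage of every
Hodge-origin class is a `ℚ`-algebraic class of `X_k`, the predicate holds:
`ratAlgebraicClasses_le_tateClasses`).

## Design notes

* The glue `hP : P.dR = C.dR`. `PeriodRealization K` bundles its de Rham realization `P.dR` while
  `CrystallineRealization p k` bundles `C.dR`; the Hodge condition lives on the former, `bo` lands
  in the latter. Lacking a period structure parametrised by a given de Rham realization, the two
  are identified by an equation of structures and classes are transported by
  `DeRhamRealization.objCast` (the identity when `hP` is `rfl`, `objCast_rfl`; a consumer building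
  `P` with `dR := C.dR` has `hP := rfl` definitionally). This is a stopgap to be removed when such a
  parametrised structure lands; the mathematical content is unaffected.
* `α` is native on the crystalline side (`C.dR.obj (genericFibre 𝒳) (2r)`, where `bo` lands and
  where the route consumes the conclusion); the cast sits in the Hodge hypothesis only.
* Binders: `C`, `P`, `hP` explicit and first, `(n, 𝒳)` last; `ι : K →+* ℂ` and the smoothness
  witness `hXι` of `X_K ⊗_ι ℂ` are quantified over as in `PeriodRealization.IsAbsoluteHodge` (if
  `k` is too big for `K` to embed into `ℂ` the predicate is vacuous — harmless).
* Not here: the number-field / linear-Frobenius form (`Motives/AbsolutelyTateClasses`); Hope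
  (4.11.3); Ogus's Prop. 4.15.

## References

* [Ogus1982] A. Ogus, *Hodge cycles and crystalline cohomology*, in LNM 900 (1982), §4:
  (4.1.2), (4.1.3), (4.4.2), (4.11), Thm. 4.14.
* [BerthelotOgus1983] P. Berthelot, A. Ogus, Invent. Math. 72 (1983), Thm. 2.4, Cor. 2.5,
  Cor. 3.7, Thm. 4.3.
* [Blasius1994] D. Blasius, *A p-adic property of Hodge classes on abelian varieties*, PSPM 55.2.
* [Deligne1982HodgeCycles] P. Deligne, LNM 900 (1982), Thm. 2.11.
-/

universe u

open CategoryTheory AlgebraicGeometry Opposite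
open scoped TensorProduct Isocrystal

noncomputable section

namespace Literature.AlgebraicGeometry.Motives

/-! ### Glue: transport along an equality of de Rham realizations -/

namespace DeRhamRealization

variable {K : Type u} [Field K] [CharZero K]

/-- Transport of cohomology classes along an EQUALITY `D = D'` of de Rham realizations: the
identity `Hⁱ_D(X) ≃ₗ Hⁱ_{D'}(X)` (glue between hypothesis structures that each bundle a de Rham
realization, e.g. `PeriodRealization.dR` and `CrystallineRealization.dR`). [folklore] -/
def objCast {D D' : DeRhamRealization K} (h : D = D') (X : SchemeOver K) (i : ℕ) :
    D.obj X i ≃ₗ[K] D'.obj X i := by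
  subst h
  exact LinearEquiv.refl K _

/-- Along `rfl` the transport is the identity. [folklore] -/
@[simp]
theorem objCast_rfl (D : DeRhamRealization K) (X : SchemeOver K) (i : ℕ) :
    objCast (rfl : D = D) X i = LinearEquiv.refl K (D.obj X i) :=
  rfl

end DeRhamRealization

namespace CrystallineRealization

open WittScheme

variable {p : ℕ} [Fact p.Prime] {k : Type} [Field k] [CharP k p] [PerfectRing k p]
  (C : CrystallineRealization p k)

/-! ### Crystalline Tate classes at a `W(k)`-model (Ogus (4.1.2) at one `W`-valued point) -/

/-- **Crystalline Tate class at the model `𝒳`** (Ogus 1982, (4.1.2), at one `W(k)`-valued point;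
semilinear Frobenius, on the nose). For a `W(k)`-scheme `𝒳` with special fibre `X_k` and generic
fibre `X_K`, `K = W(k)[1/p]`, the de Rham class `α ∈ H²ʳ_dR(X_K/K)` is a *crystalline Tate class
at `𝒳`* if every `x ∈ H²ʳ(X_k) = H²ʳ_cris(X_k/W) ⊗ K` carried to `α` by the Berthelot–Ogus map
(`C.bo 𝒳`) satisfies `φ x = pʳ x` (`C.tateClasses`): "`ξ` is a Tate class at `σ` iff
`Φ σ_cris(ξ) = σ_cris(ξ)`" in the twisted normalisation. For `𝒳` smooth proper `bo` is bijective
and "every" means "the" (`isTateAtModel_bo_iff`). [cite: Ogus1982, §4 (4.1.2)] -/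
def IsTateAtModel (𝒳 : SchemeOver (WittVector p k)) (r : ℕ)
    (α : C.dR.obj (genericFibre 𝒳) (2 * r)) : Prop :=
  ∀ x : C.obj (specialFibre 𝒳) (2 * r), C.bo 𝒳 (2 * r) x = α → x ∈ C.tateClasses (specialFibre 𝒳) r

variable {C}

/-- Unfolding of `IsTateAtModel`. [cite: Ogus1982, §4 (4.1.2)] -/
theorem isTateAtModel_iff {𝒳 : SchemeOver (WittVector p k)} {r : ℕ}
    {α : C.dR.obj (genericFibre 𝒳) (2 * r)} :
    C.IsTateAtModel 𝒳 r α ↔ ∀ x : C.obj (specialFibre 𝒳) (2 * r),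
      C.bo 𝒳 (2 * r) x = α → C.frobK (specialFibre 𝒳) (2 * r) x = ((p : K(p, k)) ^ r) • x :=
  Iff.rfl

variable {n : ℕ} {𝒳 : SchemeOver (WittVector p k)}

/-- For `𝒳/W(k)` smooth proper (so that `bo` is injective, `bijective_bo`), the image `bo x` of
`x ∈ H²ʳ(X_k)` is a crystalline Tate class at `𝒳` iff `φ x = pʳ x`. [cite: BerthelotOgus1983, Cor. 2.5] -/
theorem isTateAtModel_bo_iff (h𝒳 : IsSmoothProperModel n 𝒳) (r : ℕ)
    (x : C.obj (specialFibre 𝒳) (2 * r)) :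
    C.IsTateAtModel 𝒳 r (C.bo 𝒳 (2 * r) x) ↔ x ∈ C.tateClasses (specialFibre 𝒳) r :=
  ⟨fun h => h x rfl, fun h y hy => by rwa [(C.bijective_bo h𝒳 (2 * r)).1 hy]⟩

/-- **Chern characters of bundles on the model are crystalline Tate.** For a vector bundle `E` on a
smooth proper `𝒳/W(k)`, the de Rham Chern character `chᵣ(E|X_K) ∈ H²ʳ_dR(X_K/K)` is a crystalline
Tate class at `𝒳`: its `bo`-preimage is `chᵣ^cris(E|X_k)` (Berthelot–Ogus 1983, Cor. 3.7 /
Rem. 3.7.1: `bo_chCris`), a Tate class (`φ chᵣ = pʳ chᵣ`, Gros 1985 / Gillet–Messing 1987: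
`frobK_chCris`). [cite: BerthelotOgus1983, Cor. 3.7] -/
theorem isTateAtModel_chDR_restrictGeneric (h𝒳 : IsSmoothProperModel n 𝒳) (E : 𝒳.left.Modules)
    (hE : IsVectorBundle E) (r : ℕ) :
    C.IsTateAtModel 𝒳 r (C.chDR (genericFibre 𝒳) (restrictGeneric 𝒳 E) r) := by
  rw [← C.bo_chCris h𝒳 E hE r, isTateAtModel_bo_iff h𝒳]
  exact C.frobK_chCris h𝒳.isSmoothProjective_specialFibre _ r

/-- A class all of whose `bo`-preimages are `ℚ`-algebraic classes of the special fibre is a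
crystalline Tate class at `𝒳` (`ratAlgebraicClasses_le_tateClasses`; Ogus 1982, p. 364). [cite: Ogus1982, §4, p. 364] -/
theorem isTateAtModel_of_forall_mem_ratAlgebraicClasses (h𝒳 : IsSmoothProperModel n 𝒳) (r : ℕ)
    {α : C.dR.obj (genericFibre 𝒳) (2 * r)}
    (h : ∀ x : C.obj (specialFibre 𝒳) (2 * r), C.bo 𝒳 (2 * r) x = α →
      x ∈ C.ratAlgebraicClasses (specialFibre 𝒳) r) :
    C.IsTateAtModel 𝒳 r α :=
  fun x hx => C.ratAlgebraicClasses_le_tateClasses h𝒳.isSmoothProjective_specialFibre r (h x hx)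

/-! ### Hodge ⇒ crystalline Tate at a model ((4.11.1) ∧ (4.11.2) at one `W(k)`-point, as a property) -/

variable (C)

/-- **The Hodge classes of `X_K` are crystalline Tate at the model `𝒳`** (the property in Ogus
1982, (4.11.1) with (4.11.2), at one `W(k)`-valued point, on the nose; the shape of the input
`OgusCrystallineTate` of the Hodge summit's route `PadicSemiregularLift`). Data: the crystalline
realization `C` over `k`, a period
realization `P` over `K = W(k)[1/p]` with the SAME de Rham realization (`hP : P.dR = C.dR`; classes
are transported by `DeRhamRealization.objCast hP.symm`, the identity when `hP` is `rfl`), and a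
`W(k)`-scheme `𝒳` (intended: a smooth proper model of relative dimension `n`,
`IsSmoothProperModel n 𝒳`). Statement: for every `r`, every `α ∈ H²ʳ_dR(X_K/K)` and every
embedding `ι : K →+* ℂ` (with smoothness witness `hXι` of `X_K ⊗_ι ℂ`), if `α` is a Hodge class
relative to `ι` — `iso_ι (1 ⊗ α) = (2πi)ʳ (1 ⊗ β)` for a RATIONAL Hodge class `β` on `X_K ⊗_ι ℂ`
(`PeriodRealization.IsHodgeRelativeTo`, Ogus (4.1.1)) — then `α` is a crystalline Tate class at
`𝒳`: `φ (bo⁻¹ α) = pʳ bo⁻¹ α`. A `Prop`-valued DEFINITION — a PROPERTY of the data `C`, `P` and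
of `(n, 𝒳)`, consumed by routes as a hypothesis; no universal assertion is made here. Proved
instances: models all of whose Hodge-origin classes have `ℚ`-algebraic `bo`-preimages
(`hodgeClassesAreCrystallineTate_of_forall_mem_ratAlgebraicClasses`); for the classical data,
abelian varieties, Fermat hypersurfaces, K3 surfaces (Ogus 1982, Thm. 4.14 — not formalised
here). Model-wise, hence formally stronger at the given prime than Ogus's "absolutely Tate" (which
discards finitely many primes). [cite: Ogus1982, §4 (4.1.2), (4.11.1)–(4.11.2), Thm. 4.14] -/
def HodgeClassesAreCrystallineTate (P : PeriodRealization K(p, k)) (hP : P.dR = C.dR) (n : ℕ)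
    (𝒳 : SchemeOver (WittVector p k)) : Prop :=
  ∀ (r : ℕ) (α : C.dR.obj (genericFibre 𝒳) (2 * r)) (ι : K(p, k) →+* ℂ)
    (hXι : IsSmoothProjective n ((baseChangeHom ι).obj (genericFibre 𝒳))),
    P.IsHodgeRelativeTo ι hXι r (DeRhamRealization.objCast hP.symm (genericFibre 𝒳) (2 * r) α) →
      C.IsTateAtModel 𝒳 r α

variable {C} {P : PeriodRealization K(p, k)} {hP : P.dR = C.dR}

/-- Unfolding of `HodgeClassesAreCrystallineTate`. [cite: Ogus1982, §4 (4.11)] -/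
theorem hodgeClassesAreCrystallineTate_iff (n : ℕ) (𝒳 : SchemeOver (WittVector p k)) :
    C.HodgeClassesAreCrystallineTate P hP n 𝒳 ↔
      ∀ (r : ℕ) (α : C.dR.obj (genericFibre 𝒳) (2 * r)) (ι : K(p, k) →+* ℂ)
        (hXι : IsSmoothProjective n ((baseChangeHom ι).obj (genericFibre 𝒳))),
        P.IsHodgeRelativeTo ι hXι r
            (DeRhamRealization.objCast hP.symm (genericFibre 𝒳) (2 * r) α) →
          ∀ x : C.obj (specialFibre 𝒳) (2 * r), C.bo 𝒳 (2 * r) x = α →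
            C.frobK (specialFibre 𝒳) (2 * r) x = ((p : K(p, k)) ^ r) • x :=
  Iff.rfl

/-- **The shape consumed by the route** (`SemiregularSeedsOnAnchors`: classes "φ-Tate on the nose
and of Hodge origin"): under `HodgeClassesAreCrystallineTate`, if `bo x` is a Hodge class relative
to some `ι` then `φ x = pʳ x`, i.e. Hodge origin alone already gives `x ∈ tateClasses`. [cite: Ogus1982, §4 (4.11)] -/
theorem HodgeClassesAreCrystallineTate.mem_tateClasses
    (h : C.HodgeClassesAreCrystallineTate P hP n 𝒳) {r : ℕ} (x : C.obj (specialFibre 𝒳) (2 * r))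
    (ι : K(p, k) →+* ℂ) (hXι : IsSmoothProjective n ((baseChangeHom ι).obj (genericFibre 𝒳)))
    (hx : P.IsHodgeRelativeTo ι hXι r
      (DeRhamRealization.objCast hP.symm (genericFibre 𝒳) (2 * r) (C.bo 𝒳 (2 * r) x))) :
    x ∈ C.tateClasses (specialFibre 𝒳) r :=
  h r _ ι hXι hx x rfl

/-- **Algebraicity implies the predicate.** If for the smooth proper model `𝒳` every
`bo`-preimage of every de Rham class of Hodge origin is a `ℚ`-algebraic class of the special fibre
(what algebraicity of the rational Hodge classes of `X_K ⊗_ι ℂ` gives after descent to `K` and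
specialisation of cycles to `X_k`), then the Hodge classes are crystalline Tate at `𝒳`
(`ratAlgebraicClasses_le_tateClasses`). [cite: Ogus1982, §4, p. 364] -/
theorem hodgeClassesAreCrystallineTate_of_forall_mem_ratAlgebraicClasses
    (h𝒳 : IsSmoothProperModel n 𝒳)
    (h : ∀ (r : ℕ) (α : C.dR.obj (genericFibre 𝒳) (2 * r)) (ι : K(p, k) →+* ℂ)
      (hXι : IsSmoothProjective n ((baseChangeHom ι).obj (genericFibre 𝒳))),
      P.IsHodgeRelativeTo ι hXι r
          (DeRhamRealization.objCast hP.symm (genericFibre 𝒳) (2 * r) α) →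
        ∀ x : C.obj (specialFibre 𝒳) (2 * r), C.bo 𝒳 (2 * r) x = α →
          x ∈ C.ratAlgebraicClasses (specialFibre 𝒳) r) :
    C.HodgeClassesAreCrystallineTate P hP n 𝒳 :=
  fun r _ ι hXι hα => isTateAtModel_of_forall_mem_ratAlgebraicClasses h𝒳 r (h r _ ι hXι hα)

end CrystallineRealization

end Literature.AlgebraicGeometry.Motives

end
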